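import Summits.PneNP.PneNP.Theorems.ChebyshevTracialDesignPseudoMatchingRecursion

/-!
# Cell pnp-psdrank, route `ChebyshevTracialDesign`: the pseudo-matching FORM recursion and the induction from the threshold —
# matching-side low-degree pricing from a FINITE base certificate (crux `TracialDecayExp20`, stmt-PneNP-19878; eng g13, MEMO-13 §4(e))

Continuation of `…PseudoMatchingRecursion` (the moment recursion `(|W|−1)·ν_W(B) = Σ_v [B not killed by v]·ν_{W∖{w₀,v}}(B∖{w₀v})`).
* §1 **`form_recursion`** — for the one-clique pseudo-matching form `Q_W(δ) = Σ_{A,A'} δ_A δ_{A'} ν_W(A ∪ A')` on coefficient vectors indexed by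
  `{A : |A| ≤ k}` and `4k + 3 ≤ |W|`: `(|W|−1)·Q_W(δ) = Σ_{v ∈ W∖w₀} Q_{W∖{w₀,v}}(R_v δ)` with the substituted coefficients
  `(R_vδ)(A″) = Σ_{A not killed by v, A∖{w₀v} = A″} δ_A` — Potechin's story functional of the odd clique conditions on the partner of a vertex
  exactly like the uniform perfect matching of an even clique [cite: Potechin2019, Example 3.4 (LIPIcs 124, 61:7)].
* §2 **`form_nonneg_of_base`** — hence positive semidefiniteness at clique size `m₀ ≥ 4k+1` (for all `W ⊆ [n]` of that size) propagates to all
  sizes `m₀ + 2i`: Potechin's Theorem 1.2 for every odd clique follows from the THRESHOLD size `4k+1` [cite: Potechin2019, Thm. 1.2 (61:4)], a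
  finite statement for each `k` (MEMO-13 §4(e): exact LDLᵀ certificates at (m,k) = (5,1), (9,2)).
* §3 **`sum_levelWeight_trace_nonpos_of_lowDegreeM_of_base`** — matching-side low-degree pricing (brick `…PseudoMatchingTensor`) from the base:
  `n` even, an exact design of degree `D ≥ 2k` on the `t`-cuts with `4k+1 ≤ t` and `4k+1 ≤ n−t`, `X` ARBITRARY psd, `IsLowDegreeM n k B`, and the
  pseudo-matching form nonnegative on every `(4k+1)`-subset of `[n]` ⇒ `Σ_U Σ_M levelWeight(U,M)·tr(X_U B_M B_Mᵀ) ≤ 0`.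
No definitions (`ν` is a parameter with its closed form as hypothesis). Stature: support/instrument (finite algebra; axioms standard; §3 conditional
on the base certificate). WHAT THIS IS NOT: not the base case, nothing on the dense cell, nothing on psd rank, no P-vs-NP content. Supports stmt-PneNP-19878.
-/

set_option linter.dupNamespace false -- `Summit.PneNP.PneNP.…`: summit = sub-problem (D-0017)

noncomputable section

namespace Summit.PneNP.PneNP.Theorems.ChebyshevTracialDesignPseudoMatchingFormRecursion

open Finset Matrix Literature.Barriers.PneNP Literature.Combinatorics.Optimization
open Summit.PneNP.PneNP.Theorems.ChebyshevTracialDesignJunta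
open Summit.PneNP.PneNP.Theorems.ChebyshevTracialDesignPseudoMatchingTensor
open Summit.PneNP.PneNP.Theorems.ChebyshevTracialDesignPseudoMatchingRecursion
open scoped MatrixOrder

variable {n : ℕ}

/-! ### §1 The form recursion -/

/-- Killing is inherited by unions: `A ∪ A'` is killed by `v` iff `A` or `A'` is. [folklore] -/
theorem kill_union_iff (w₀ v : Fin n) (A A' : Finset (Sym2 (Fin n))) :
    (∃ e ∈ A ∪ A', (w₀ ∈ e ∨ v ∈ e) ∧ e ≠ s(w₀, v)) ↔
      (∃ e ∈ A, (w₀ ∈ e ∨ v ∈ e) ∧ e ≠ s(w₀, v)) ∨ (∃ e ∈ A', (w₀ ∈ e ∨ v ∈ e) ∧ e ≠ s(w₀, v)) := by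
  constructor
  · rintro ⟨e, he, h⟩
    rcases mem_union.1 he with he | he
    · exact Or.inl ⟨e, he, h⟩
    · exact Or.inr ⟨e, he, h⟩
  · rintro (⟨e, he, h⟩ | ⟨e, he, h⟩)
    · exact ⟨e, mem_union_left _ he, h⟩
    · exact ⟨e, mem_union_right _ he, h⟩

/-- **FORM RECURSION.** For the pseudo-matching functional `ν` (closed form `hν`), `w₀ ∈ W`, `4k + 3 ≤ |W|` and every coefficient vector `δ`
on `{A : |A| ≤ k}`: `(|W|−1)·Σ_{A,A'} δ_A δ_{A'} ν_W(A ∪ A') = Σ_{v ∈ W∖w₀} Σ_{A″,A‴} (R_vδ)(A″)(R_vδ)(A‴) ν_{W∖{w₀,v}}(A″ ∪ A‴)`, where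
`(R_vδ)(A″) = Σ_{A : A not killed by v, A∖{w₀v} = A″} δ_A`. [cite: Potechin2019, Example 3.4 (LIPIcs 124, 61:7)] -/
theorem form_recursion (ν : Finset (Fin n) → Finset (Sym2 (Fin n)) → ℝ)
    (hν : ∀ W G, ν W G = if ((univ : Finset (PMatch n)).filter fun M => G ⊆ M.1).Nonempty ∧ (∀ e ∈ G, ∀ x ∈ e, x ∈ W) then
      (∏ j ∈ range G.card, ((W.card : ℝ) - 1 - 2 * j))⁻¹ else 0)
    {k : ℕ} {W : Finset (Fin n)} {w₀ : Fin n} (hw₀ : w₀ ∈ W) (hW : 4 * k + 3 ≤ W.card)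
    (δ : {A : Finset (Sym2 (Fin n)) // A.card ≤ k} → ℝ) :
    ((W.card : ℝ) - 1) * ∑ A, ∑ A', δ A * δ A' * ν W (A.1 ∪ A'.1) =
      ∑ v ∈ W.erase w₀,
        ∑ A'' : {A : Finset (Sym2 (Fin n)) // A.card ≤ k}, ∑ A''' : {A : Finset (Sym2 (Fin n)) // A.card ≤ k},
          (∑ A ∈ univ.filter (fun A : {A : Finset (Sym2 (Fin n)) // A.card ≤ k} =>
              (⟨A.1.erase s(w₀, v), (card_erase_le).trans A.2⟩ : {A : Finset (Sym2 (Fin n)) // A.card ≤ k}) = A''),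
            (if ∃ e ∈ A.1, (w₀ ∈ e ∨ v ∈ e) ∧ e ≠ s(w₀, v) then 0 else δ A)) *
          (∑ A' ∈ univ.filter (fun A' : {A : Finset (Sym2 (Fin n)) // A.card ≤ k} =>
              (⟨A'.1.erase s(w₀, v), (card_erase_le).trans A'.2⟩ : {A : Finset (Sym2 (Fin n)) // A.card ≤ k}) = A'''),
            (if ∃ e ∈ A'.1, (w₀ ∈ e ∨ v ∈ e) ∧ e ≠ s(w₀, v) then 0 else δ A')) *
          ν (W \ {w₀, v}) (A''.1 ∪ A'''.1) := by
  classical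
  -- regroup each `v`-term along the fibres of `A ↦ A ∖ {w₀v}`
  have hreg : ∀ v ∈ W.erase w₀,
      ∑ A'' : {A : Finset (Sym2 (Fin n)) // A.card ≤ k}, ∑ A''' : {A : Finset (Sym2 (Fin n)) // A.card ≤ k},
          (∑ A ∈ univ.filter (fun A : {A : Finset (Sym2 (Fin n)) // A.card ≤ k} =>
              (⟨A.1.erase s(w₀, v), (card_erase_le).trans A.2⟩ : {A : Finset (Sym2 (Fin n)) // A.card ≤ k}) = A''),
            (if ∃ e ∈ A.1, (w₀ ∈ e ∨ v ∈ e) ∧ e ≠ s(w₀, v) then 0 else δ A)) *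
          (∑ A' ∈ univ.filter (fun A' : {A : Finset (Sym2 (Fin n)) // A.card ≤ k} =>
              (⟨A'.1.erase s(w₀, v), (card_erase_le).trans A'.2⟩ : {A : Finset (Sym2 (Fin n)) // A.card ≤ k}) = A'''),
            (if ∃ e ∈ A'.1, (w₀ ∈ e ∨ v ∈ e) ∧ e ≠ s(w₀, v) then 0 else δ A')) *
          ν (W \ {w₀, v}) (A''.1 ∪ A'''.1) =
        ∑ A : {A : Finset (Sym2 (Fin n)) // A.card ≤ k}, ∑ A' : {A : Finset (Sym2 (Fin n)) // A.card ≤ k},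
          δ A * δ A' * (if ∃ e ∈ A.1 ∪ A'.1, (w₀ ∈ e ∨ v ∈ e) ∧ e ≠ s(w₀, v) then 0
            else ν (W \ {w₀, v}) ((A.1 ∪ A'.1).erase s(w₀, v))) := by
    intro v hv
    rw [← sum_sum_fiber_regroup
      (fun A : {A : Finset (Sym2 (Fin n)) // A.card ≤ k} =>
        (⟨A.1.erase s(w₀, v), (card_erase_le).trans A.2⟩ : {A : Finset (Sym2 (Fin n)) // A.card ≤ k}))
      (fun A => if ∃ e ∈ A.1, (w₀ ∈ e ∨ v ∈ e) ∧ e ≠ s(w₀, v) then 0 else δ A)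
      (fun A => if ∃ e ∈ A.1, (w₀ ∈ e ∨ v ∈ e) ∧ e ≠ s(w₀, v) then 0 else δ A)
      (fun c c' => ν (W \ {w₀, v}) (c.1 ∪ c'.1))]
    refine sum_congr rfl fun A _ => sum_congr rfl fun A' _ => ?_
    simp only [kill_union_iff, erase_union_distrib]
    by_cases h1 : ∃ e ∈ A.1, (w₀ ∈ e ∨ v ∈ e) ∧ e ≠ s(w₀, v)
    · simp only [h1, if_true, zero_mul, true_or, mul_zero]
    · by_cases h2 : ∃ e ∈ A'.1, (w₀ ∈ e ∨ v ∈ e) ∧ e ≠ s(w₀, v)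
      · simp only [h1, h2, if_true, if_false, mul_zero, zero_mul, or_true]
      · simp only [h1, h2, if_false, or_self]
  rw [sum_congr rfl hreg]
  -- exchange the sums and apply the moment recursion to each `B = A ∪ A'`
  have hswap : (∑ v ∈ W.erase w₀, ∑ A : {A : Finset (Sym2 (Fin n)) // A.card ≤ k}, ∑ A' : {A : Finset (Sym2 (Fin n)) // A.card ≤ k},
      δ A * δ A' * (if ∃ e ∈ A.1 ∪ A'.1, (w₀ ∈ e ∨ v ∈ e) ∧ e ≠ s(w₀, v) then 0
        else ν (W \ {w₀, v}) ((A.1 ∪ A'.1).erase s(w₀, v)))) =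
      ∑ A : {A : Finset (Sym2 (Fin n)) // A.card ≤ k}, ∑ A' : {A : Finset (Sym2 (Fin n)) // A.card ≤ k}, ∑ v ∈ W.erase w₀,
        δ A * δ A' * (if ∃ e ∈ A.1 ∪ A'.1, (w₀ ∈ e ∨ v ∈ e) ∧ e ≠ s(w₀, v) then 0
          else ν (W \ {w₀, v}) ((A.1 ∪ A'.1).erase s(w₀, v))) := by
    rw [sum_comm]; exact sum_congr rfl fun A _ => sum_comm
  rw [hswap, mul_sum]
  refine sum_congr rfl fun A _ => ?_
  rw [mul_sum]
  refine sum_congr rfl fun A' _ => ?_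
  have hBc : 2 * (A.1 ∪ A'.1).card + 3 ≤ W.card := by
    have := card_union_le A.1 A'.1
    have := A.2; have := A'.2
    omega
  rw [mul_left_comm, moment_recursion ν hν hw₀ hBc, mul_sum]

/-! ### §2 Positive semidefiniteness propagates from the threshold size -/

/-- **INDUCTION FROM THE BASE.** If the pseudo-matching form is nonnegative on `{A : |A| ≤ k}` for every `W ⊆ [n]` of size `m₀ ≥ 4k+1`, then it is
nonnegative for every `W` of size `m₀ + 2i`. [cite: Potechin2019, Thm. 1.2 and Cor. 3.10 (LIPIcs 124, 61:4, 61:9)] -/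
theorem form_nonneg_of_base (ν : Finset (Fin n) → Finset (Sym2 (Fin n)) → ℝ)
    (hν : ∀ W G, ν W G = if ((univ : Finset (PMatch n)).filter fun M => G ⊆ M.1).Nonempty ∧ (∀ e ∈ G, ∀ x ∈ e, x ∈ W) then
      (∏ j ∈ range G.card, ((W.card : ℝ) - 1 - 2 * j))⁻¹ else 0)
    {k m₀ : ℕ} (hm₀ : 4 * k + 1 ≤ m₀)
    (hbase : ∀ W : Finset (Fin n), W.card = m₀ → ∀ δ : {A : Finset (Sym2 (Fin n)) // A.card ≤ k} → ℝ,
      0 ≤ ∑ A, ∑ A', δ A * δ A' * ν W (A.1 ∪ A'.1)) :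
    ∀ (i : ℕ) (W : Finset (Fin n)), W.card = m₀ + 2 * i → ∀ δ : {A : Finset (Sym2 (Fin n)) // A.card ≤ k} → ℝ,
      0 ≤ ∑ A, ∑ A', δ A * δ A' * ν W (A.1 ∪ A'.1) := by
  classical
  intro i
  induction i with
  | zero => intro W hW δ; exact hbase W (by simpa using hW) δ
  | succ i ih =>
    intro W hW δ
    have hWge : 4 * k + 3 ≤ W.card := by rw [hW]; omega
    obtain ⟨w₀, hw₀⟩ : W.Nonempty := card_pos.1 (by omega)
    have hrec := form_recursion ν hν hw₀ hWge δ
    have hpos : (0 : ℝ) < (W.card : ℝ) - 1 := by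
      have : (3 : ℝ) ≤ W.card := by exact_mod_cast (by omega : 3 ≤ W.card)
      linarith
    -- every term on the right is a form at size `m₀ + 2i`, hence nonnegative
    have hrhs : 0 ≤ ((W.card : ℝ) - 1) * ∑ A, ∑ A', δ A * δ A' * ν W (A.1 ∪ A'.1) := by
      rw [hrec]
      refine sum_nonneg fun v hv => ?_
      have hcard : (W \ {w₀, v}).card = m₀ + 2 * i := by
        have hv' := mem_erase.1 hv
        rw [card_sdiff_of_subset (by
              intro x hx; rcases mem_insert.1 hx with rfl | hx
              · exact hw₀
              · rw [mem_singleton.1 hx]; exact hv'.2),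
          card_pair hv'.1.symm, hW]
        omega
      exact ih _ hcard _
    by_contra hneg
    push Not at hneg
    have := mul_neg_of_pos_of_neg hpos hneg
    linarith

/-! ### §3 Matching-side low-degree pricing from the base certificate -/

/-- `cutCount U e = 2` iff both ends of `e` lie in `U`. [folklore] -/
theorem cutCount_eq_two_iff (U : Finset (Fin n)) (e : Sym2 (Fin n)) : cutCount U e = 2 ↔ ∀ x ∈ e, x ∈ U := by
  constructor
  · exact fun h x hx => mem_of_cutCount_two h hx
  · intro h
    induction e using Sym2.ind with
    | h a b => rw [cutCount_mk, if_pos (h a (Sym2.mem_mk_left _ _)), if_pos (h b (Sym2.mem_mk_right _ _))]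

/-- `cutCount U e = 0` iff both ends of `e` lie outside `U`. [folklore] -/
theorem cutCount_eq_zero_iff (U : Finset (Fin n)) (e : Sym2 (Fin n)) :
    cutCount U e = 0 ↔ ∀ x ∈ e, x ∈ (univ : Finset (Fin n)) \ U := by
  constructor
  · exact fun h x hx => mem_sdiff.2 ⟨mem_univ _, not_mem_of_cutCount_zero h hx⟩
  · intro h
    induction e using Sym2.ind with
    | h a b =>
      rw [cutCount_mk, if_neg (mem_sdiff.1 (h a (Sym2.mem_mk_left _ _))).2, if_neg (mem_sdiff.1 (h b (Sym2.mem_mk_right _ _))).2]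

/-- **MATCHING-SIDE LOW-DEGREE PRICING FROM THE BASE CERTIFICATE.** Let `n` be even, `(C, w)` an exact design of degree `D` on the `t`-cuts with
`4k+1 ≤ t` and `4k+1 ≤ n − t`, `X` an ARBITRARY psd cut family, `B` of matching-degree `≤ k` (`2k ≤ D`). If the pseudo-matching form
`δ ↦ Σ_{A,A'} δ_A δ_{A'} ν_W(A ∪ A')` is nonnegative on `{A : |A| ≤ k}` for every `W ⊆ [n]` with `|W| = 4k+1` (the threshold certificate), then
`Σ_U Σ_M levelWeight(U,M)·tr(X_U B_M B_Mᵀ) ≤ 0`. [cite: Potechin2019, Thm. 1.2 (LIPIcs 124, 61:4)] [cite: Rothvoss2017, §2 (PDF p. 6)] -/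
theorem sum_levelWeight_trace_nonpos_of_lowDegreeM_of_base (hn : Even n) {t T D : ℕ} {Bv : ℝ} {C : Finset ℕ} {w : ℕ → ℝ}
    (hdes : IsExactDesign n t T D Bv C w) {r m k : ℕ} (h2k : 2 * k ≤ D) (hkt : 4 * k + 1 ≤ t) (hknt : 4 * k + 1 ≤ n - t)
    (X : OddSet n → Matrix (Fin r) (Fin r) ℝ) (hX : ∀ U, (X U).PosSemidef)
    (B : PMatch n → Matrix (Fin r) (Fin m) ℝ) (hB : IsLowDegreeM n k B)
    (ν : Finset (Fin n) → Finset (Sym2 (Fin n)) → ℝ)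
    (hν : ∀ W G, ν W G = if ((univ : Finset (PMatch n)).filter fun M => G ⊆ M.1).Nonempty ∧ (∀ e ∈ G, ∀ x ∈ e, x ∈ W) then
      (∏ j ∈ range G.card, ((W.card : ℝ) - 1 - 2 * j))⁻¹ else 0)
    (hbase : ∀ W : Finset (Fin n), W.card = 4 * k + 1 → ∀ δ : {A : Finset (Sym2 (Fin n)) // A.card ≤ k} → ℝ,
      0 ≤ ∑ A, ∑ A', δ A * δ A' * ν W (A.1 ∪ A'.1)) :
    ∑ U, ∑ M, levelWeight n t C w U M * (X U * (B M * (B M)ᵀ)).trace ≤ 0 := by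
  classical
  have htodd : Odd t := hdes.1
  have htn : 2 * t + 2 ≤ n := hdes.2.1
  have hall := form_nonneg_of_base ν hν (le_refl (4 * k + 1)) hbase
  refine sum_levelWeight_trace_nonpos_of_lowDegreeM_of_clique_forms hn hdes h2k X hX B hB (fun U hUt δ => ?_) (fun U hUt δ => ?_)
  · -- the clique `U`: size `t = (4k+1) + 2i`
    obtain ⟨i, hi⟩ : ∃ i, t = 4 * k + 1 + 2 * i := by
      obtain ⟨a, ha⟩ := htodd; exact ⟨a - 2 * k, by omega⟩
    have h := hall i U.1 (by rw [hUt, hi]) δ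
    refine le_of_le_of_eq h (sum_congr rfl fun A _ => sum_congr rfl fun A' _ => ?_)
    rw [hν, hUt]
    simp only [cutCount_eq_two_iff]
  · -- the clique `Ū`: size `n − t = (4k+1) + 2i'`
    obtain ⟨i', hi'⟩ : ∃ i', n - t = 4 * k + 1 + 2 * i' := by
      obtain ⟨a, ha⟩ := htodd; obtain ⟨b, hb⟩ := hn; exact ⟨b - a - 2 * k - 1, by omega⟩
    have hcard : ((univ : Finset (Fin n)) \ U.1).card = n - t := by
      rw [card_sdiff_of_subset (subset_univ _), card_univ, Fintype.card_fin, hUt]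
    have h := hall i' ((univ : Finset (Fin n)) \ U.1) (by rw [hcard, hi']) δ
    refine le_of_le_of_eq h (sum_congr rfl fun A _ => sum_congr rfl fun A' _ => ?_)
    rw [hν, hcard]
    simp only [cutCount_eq_zero_iff]

end Summit.PneNP.PneNP.Theorems.ChebyshevTracialDesignPseudoMatchingFormRecursion
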